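import Literature.Topology.FourManifolds.SimplifiedBrokenLefschetzSides
import Literature.Topology.FourManifolds.SimplifiedBrokenLefschetzFibreSphere
import HarnessLib

/-!
# The lower and the higher side of a Lefschetz-free simplified broken Lefschetz fibration

Topic `Literature/Topology/FourManifolds`; a brick for the genus-one rung
`nonempty_diffeomorph_sphere_four_of_sblf_genus_one_noLefschetz` (Baykur–Kamada 2015, Lemma 11)
of `SimplifiedBrokenLefschetzFibration.lean`, continuing `SimplifiedBrokenLefschetzSides.lean`.
Everything here is **proved**; there are no definitions and no named facts.

Baykur–Kamada 2015, §2 (arXiv p. 7): an SBLF decomposes into *"a genus `g - 1` Lefschetz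
fibration over a `2`-disk we call the lower side, a genus `g` Lefschetz fibration over a `2`-disk
called the higher side, and a round cobordism between them"*.  For an SBLF `f : X → S²`
(`IsSimplifiedBrokenLefschetzFibration o f ∅ h`, no Lefschetz points) normalised so that its round
image is the equator `{y | y₂ = 0}` (`exists_image_round_eq_sphereEquator`), the product
structure of the two open sides (`SimplifiedBrokenLefschetzSides.lean`: the preimage of each open
hemisphere `{y | ⟪y, ±e₂⟫ < 0}` is `F± × ℝ²` fibrewise) makes the homology of the regular fibres
constant on each side; since some regular fibre has genus `h` and some has genus `h + 1`
(clauses `exists_lower`, `exists_higher`), **one open hemisphere is the lower side (all fibres of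
genus `h`) and the other is the higher side (all fibres of genus `h + 1`)**:

* `nonempty_homeomorph_preimage_singleton_of_prod_structure` — over a side with a product
  structure `ι : F × ℝⁿ⁺¹ ↪ M`, every fibre `f⁻¹(y)` is homeomorphic to `F`;
* `IsSimplifiedBrokenLefschetzFibration.nonempty_linearEquiv_of_inner_lt_zero` — hence
  `H₁(f⁻¹(y); ℤ) ≅ H₁(f⁻¹(y'); ℤ)` for `y`, `y'` on the same side;
* `IsSimplifiedBrokenLefschetzFibration.inner_ne_zero_of_regular` — regular values lie off the
  equator, i.e. on one of the two sides;
* `IsSimplifiedBrokenLefschetzFibration.exists_pole_lower_higher_sides` — **there is a pole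
  `v = ±e₂` such that every `y` with `⟪y, v⟫ < 0` is a regular value with
  `H₁(f⁻¹(y)) ≅ ℤ^{2h}` (lower side) and every `y` with `⟪y, -v⟫ < 0` is a regular value with
  `H₁(f⁻¹(y)) ≅ ℤ^{2(h+1)}` (higher side)**;
* `IsSimplifiedBrokenLefschetzFibration.exists_pole_sphere_side` — for `h = 0` (the genus-one
  SBLFs of Lemma 11): the fibres of the lower side are embedded `2`-spheres
  (`SimplifiedBrokenLefschetzFibreSphere.lean`) and those of the higher side have
  `rank H₁ = 2` (tori) — Baykur–Kamada 2015, §5: *"`X_h ≅ T² × D²`, `X_l ≅ S² × D²`"*.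

* `IsSimplifiedBrokenLefschetzFibration.exists_pole_isSmoothEmbedding_sphere_two_prod_side` —
  for `h = 0`, **the lower side is `𝕊² × ℝ²` smoothly and fibrewise**: a smooth embedding
  `ι : 𝕊² × ℝ² ↪ X` onto `f⁻¹{y | ⟪y, v⟫ < 0}` with `f (ι (θ, w)) = σᵥ⁻¹ (univBall 0 2 w)`
  (the smoothly embedded sphere fibre of `SimplifiedBrokenLefschetzFibreSphere.lean` fed into the
  product structure of `SimplifiedBrokenLefschetzSides.lean`), the opposite side being the torus
  side.

## References

* R. İ. Baykur, S. Kamada, *Classification of broken Lefschetz fibrations with small fiber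
  genera*, J. Math. Soc. Japan 67 (2015), §2 (arXiv p. 7), §5 and Lemma 11. [BaykurKamada2015]
* Th. Bröcker, K. Jänich, *Introduction to Differential Topology* (1982), (8.12).
  [BrockerJanichIDT1982]
-/

noncomputable section

open scoped Manifold ContDiff Topology InnerProductSpace EuclideanSpace
open Set Function Metric OpenPartialHomeomorph
open Literature.AlgebraicTopology.SingularHomology

namespace Literature.Topology.FourManifolds

universe u

/-! ### Fibres over a side with a product structure -/

section FibreHomeomorph

variable {n : ℕ} {M : Type*} [TopologicalSpace M] {F : Type*} [TopologicalSpace F]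

/-- **Over a side with a product structure all fibres are homeomorphic to the fibre parameter.**
If `ι : F × ℝⁿ⁺¹ → M` is a topological embedding onto `f⁻¹{y | ⟪y, v⟫ < 0}` with
`f (ι (θ, w)) = σᵥ⁻¹ (univBall 0 2 w)` (the shape delivered by
`exists_isSmoothEmbedding_prod_range_eq_preimage_hemisphere`), then for every `y` of the open
hemisphere opposite `v` the map `θ ↦ ι (θ, κ y)` is a homeomorphism `F ≃ₜ f⁻¹(y)`. [folklore] -/
theorem nonempty_homeomorph_preimage_singleton_of_prod_structure
    {f : M → (Metric.sphere (0 : EuclideanSpace ℝ (Fin (n + 1 + 1))) 1)} {v : (Metric.sphere (0 :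
          EuclideanSpace ℝ (Fin (n + 1 + 1))) 1)} {ι : F × EuclideanSpace ℝ (Fin (n + 1)) → M}
          (hemb : Topology.IsEmbedding ι)
    (hrange : range ι = f ⁻¹' {y | ⟪(y : EuclideanSpace ℝ (Fin (n + 1 + 1))),
          (v : EuclideanSpace ℝ (Fin (n + 1 + 1)))⟫_ℝ < 0})
    (hιf : ∀ p, f (ι p) = (stereographic' (n + 1) v).symm (univBall (0 : EuclideanSpace ℝ (Fin (n +
          1))) 2 p.2))
    {y : (Metric.sphere (0 : EuclideanSpace ℝ (Fin (n + 1 + 1))) 1)} (hy : ⟪(y : EuclideanSpace ℝ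
          (Fin (n + 1 + 1))), (v : EuclideanSpace ℝ (Fin (n + 1 + 1)))⟫_ℝ < 0) :
    Nonempty (F ≃ₜ ↥(f ⁻¹' {y})) := by
  set w : EuclideanSpace ℝ (Fin (n + 1)) := (univBall (0 : EuclideanSpace ℝ (Fin (n + 1))) 2).symm
        (stereographic' (n + 1) v y) with hw
  have hyw : (stereographic' (n + 1) v).symm (univBall (0 : EuclideanSpace ℝ (Fin (n + 1))) 2 w) =
        y :=
    stereographic'_symm_univBall_univBall_symm_stereographic' hy
  set g : F → M := fun θ ↦ ι (θ, w) with hg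
  have hgemb : Topology.IsEmbedding g := hemb.comp (isEmbedding_prodMkLeft w)
  have hgrange : range g = f ⁻¹' {y} := by
    ext x
    simp only [mem_range, mem_preimage, mem_singleton_iff, hg]
    constructor
    · rintro ⟨θ, rfl⟩
      rw [hιf, hyw]
    · intro hx
      have hxU : x ∈ range ι := by
        rw [hrange, mem_preimage, mem_setOf_eq, hx]
        exact hy
      obtain ⟨⟨θ, w'⟩, rfl⟩ := hxU
      have hw' : w' = w := by
        rw [hw, ← hx, hιf, univBall_symm_stereographic'_stereographic'_symm_univBall]
      subst hw'
      exact ⟨θ, rfl⟩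
  exact ⟨hgemb.toHomeomorph.trans (Homeomorph.setCongr hgrange)⟩

end FibreHomeomorph

/-! ### The lower and the higher side of a Lefschetz-free SBLF -/

namespace IsSimplifiedBrokenLefschetzFibration

variable {X : Type u} [TopologicalSpace X] [T2Space X] [SecondCountableTopology X]
  [CompactSpace X] [ChartedSpace (EuclideanSpace ℝ (Fin 4)) X] [IsManifold (𝓡 4) ∞ X]
  {o : SmoothOrientation (𝓡 4) X} {f : X → (Metric.sphere (0 : EuclideanSpace ℝ (Fin 3)) 1)} {h : ℕ}

/-- **The first homology of the regular fibres is constant on each side** of a Lefschetz-free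
SBLF with equatorial round image (`v = ±e₂`): all fibres over the open hemisphere opposite `v`
are homeomorphic to the fibre parameter `F` of the product structure
`exists_isSmoothEmbedding_prod_range_eq_preimage_hemisphere`.
[cite: BaykurKamada2015, §2 (arXiv p. 7)] -/
theorem nonempty_linearEquiv_of_inner_lt_zero (hf : IsSimplifiedBrokenLefschetzFibration o f ∅ h)
    (hround : f '' ({p : X | ¬ Surjective (mfderiv (𝓡 4) (𝓡 2) f p)} \
      (↑(∅ : Finset X) : Set X)) = sphereEquator 1)
    {v : (Metric.sphere (0 : EuclideanSpace ℝ (Fin 3)) 1)} (hv0 : (v : EuclideanSpace ℝ (Fin 3)) 0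
          = 0) (hv1 : (v : EuclideanSpace ℝ (Fin 3)) 1 = 0)
    {y y' : (Metric.sphere (0 : EuclideanSpace ℝ (Fin 3)) 1)} (hy : ⟪(y : EuclideanSpace ℝ (Fin
          3)), (v : EuclideanSpace ℝ (Fin 3))⟫_ℝ < 0) (hy' : ⟪(y' : EuclideanSpace ℝ (Fin 3)),
          (v : EuclideanSpace ℝ (Fin 3))⟫_ℝ < 0)
    {V : Type} [AddCommGroup V] [Module ℤ V]
    (e : V ≃ₗ[ℤ] singularHomology ℤ ℤ ↥(f ⁻¹' {y}) 1) :
    Nonempty (V ≃ₗ[ℤ] singularHomology ℤ ℤ ↥(f ⁻¹' {y'}) 1) := by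
  obtain ⟨F, _, _, _, _, _, _, _, ι, hemb, hrange, -, -, hιf⟩ :=
    hf.exists_isSmoothEmbedding_prod_range_eq_preimage_hemisphere hround v hv0 hv1
  obtain ⟨φ⟩ :=
    nonempty_homeomorph_preimage_singleton_of_prod_structure hemb.isEmbedding hrange hιf hy
  obtain ⟨φ'⟩ :=
    nonempty_homeomorph_preimage_singleton_of_prod_structure hemb.isEmbedding hrange hιf hy'
  exact ⟨e.trans (singularHomology.mapIso ℤ ℤ (φ.symm.trans φ') 1).toLinearEquiv⟩

omit [T2Space X] [SecondCountableTopology X] [CompactSpace X] in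
/-- **Regular values lie off the equator**: for a Lefschetz-free SBLF with equatorial round
image and a pole `v = ±e₂` (`v₀ = v₁ = 0`), a regular value `y` has `⟪y, v⟫ ≠ 0`. [folklore] -/
theorem inner_ne_zero_of_regular (hf : IsSimplifiedBrokenLefschetzFibration o f ∅ h)
    (hround : f '' ({p : X | ¬ Surjective (mfderiv (𝓡 4) (𝓡 2) f p)} \
      (↑(∅ : Finset X) : Set X)) = sphereEquator 1)
    {v : (Metric.sphere (0 : EuclideanSpace ℝ (Fin 3)) 1)} (hv0 : (v : EuclideanSpace ℝ (Fin 3)) 0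
          = 0) (hv1 : (v : EuclideanSpace ℝ (Fin 3)) 1 = 0) {y : (Metric.sphere (0 : EuclideanSpace
          ℝ (Fin 3)) 1)}
    (hy : ∀ q, f q = y → Surjective (mfderiv (𝓡 4) (𝓡 2) f q)) :
    ⟪(y : EuclideanSpace ℝ (Fin 3)), (v : EuclideanSpace ℝ (Fin 3))⟫_ℝ ≠ 0 := by
  obtain ⟨q, rfl⟩ := hf.surjective y
  have hy2 : (f q : EuclideanSpace ℝ (Fin 3)) 2 ≠ 0 := by
    intro h2
    have hmem : f q ∈ sphereEquator 1 := by
      rw [mem_sphereEquator_iff]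
      exact h2
    rw [← hround] at hmem
    obtain ⟨p, ⟨hp, -⟩, hpq⟩ := hmem
    exact hp (hy p hpq)
  have hv2 : (v : EuclideanSpace ℝ (Fin 3)) 2 ≠ 0 := by
    intro h2
    have h0 : (v : EuclideanSpace ℝ (Fin 3)) = 0 := by
      ext i
      fin_cases i <;> simp [hv0, hv1, h2]
    have := norm_eq_of_mem_sphere v
    rw [h0, norm_zero] at this
    exact zero_ne_one this
  rw [EuclideanSpace.inner_eq_star_dotProduct]
  simp [dotProduct, Fin.sum_univ_three, hv0, hv1, hy2, hv2]

omit [T2Space X] [SecondCountableTopology X] [CompactSpace X] in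
/-- A regular value lies on the side opposite `v` or on the side opposite `-v`. [folklore] -/
theorem inner_lt_zero_or_of_regular (hf : IsSimplifiedBrokenLefschetzFibration o f ∅ h)
    (hround : f '' ({p : X | ¬ Surjective (mfderiv (𝓡 4) (𝓡 2) f p)} \
      (↑(∅ : Finset X) : Set X)) = sphereEquator 1)
    {v : (Metric.sphere (0 : EuclideanSpace ℝ (Fin 3)) 1)} (hv0 : (v : EuclideanSpace ℝ (Fin 3)) 0
          = 0) (hv1 : (v : EuclideanSpace ℝ (Fin 3)) 1 = 0) {y : (Metric.sphere (0 : EuclideanSpace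
          ℝ (Fin 3)) 1)}
    (hy : ∀ q, f q = y → Surjective (mfderiv (𝓡 4) (𝓡 2) f q)) :
    ⟪(y : EuclideanSpace ℝ (Fin 3)),
          (v : EuclideanSpace ℝ (Fin 3))⟫_ℝ < 0 ∨ ⟪(y : EuclideanSpace ℝ (Fin 3)),
          ((-v : (Metric.sphere (0 : EuclideanSpace ℝ (Fin 3)) 1)) : EuclideanSpace ℝ (Fin 3))⟫_ℝ <
          0 := by
  rcases (hf.inner_ne_zero_of_regular hround hv0 hv1 hy).lt_or_gt with hlt | hgt
  · exact Or.inl hlt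
  · right
    rw [coe_neg_sphere, inner_neg_right]
    linarith

/-- The two sides for a pole `u` whose opposite hemisphere contains a genus-`h` fibre: the side
opposite `u` is the lower side, the side opposite `-u` the higher side. [cite: BaykurKamada2015, §2 (arXiv p. 7)] -/
theorem lower_higher_sides_of_pole (hf : IsSimplifiedBrokenLefschetzFibration o f ∅ h)
    (hround : f '' ({p : X | ¬ Surjective (mfderiv (𝓡 4) (𝓡 2) f p)} \
      (↑(∅ : Finset X) : Set X)) = sphereEquator 1)
    {u : (Metric.sphere (0 : EuclideanSpace ℝ (Fin 3)) 1)} (hu0 : (u : EuclideanSpace ℝ (Fin 3)) 0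
          = 0) (hu1 : (u : EuclideanSpace ℝ (Fin 3)) 1 = 0) {yl : (Metric.sphere (0 :
          EuclideanSpace ℝ (Fin 3)) 1)}
    (hyl : ⟪(yl : EuclideanSpace ℝ (Fin 3)), (u : EuclideanSpace ℝ (Fin 3))⟫_ℝ < 0)
    (el : (Fin (2 * h) → ℤ) ≃ₗ[ℤ] singularHomology ℤ ℤ ↥(f ⁻¹' {yl}) 1) :
    (∀ y : (Metric.sphere (0 : EuclideanSpace ℝ (Fin 3)) 1), ⟪(y : EuclideanSpace ℝ (Fin 3)),
          (u : EuclideanSpace ℝ (Fin 3))⟫_ℝ < 0 →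
        (∀ q, f q = y → Surjective (mfderiv (𝓡 4) (𝓡 2) f q)) ∧
        Nonempty ((Fin (2 * h) → ℤ) ≃ₗ[ℤ] singularHomology ℤ ℤ ↥(f ⁻¹' {y}) 1)) ∧
      ∀ y : (Metric.sphere (0 : EuclideanSpace ℝ (Fin 3)) 1), ⟪(y : EuclideanSpace ℝ (Fin 3)),
            ((-u : (Metric.sphere (0 : EuclideanSpace ℝ (Fin 3)) 1)) : EuclideanSpace ℝ (Fin 3))⟫_ℝ
            < 0 →
        (∀ q, f q = y → Surjective (mfderiv (𝓡 4) (𝓡 2) f q)) ∧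
        Nonempty ((Fin (2 * (h + 1)) → ℤ) ≃ₗ[ℤ] singularHomology ℤ ℤ ↥(f ⁻¹' {y}) 1) := by
  have hnu0 : ((-u : (Metric.sphere (0 : EuclideanSpace ℝ (Fin 3)) 1)) : EuclideanSpace ℝ (Fin 3))
        0 = 0 := by
    rw [coe_neg_sphere]; simp [hu0]
  have hnu1 : ((-u : (Metric.sphere (0 : EuclideanSpace ℝ (Fin 3)) 1)) : EuclideanSpace ℝ (Fin 3))
        1 = 0 := by
    rw [coe_neg_sphere]; simp [hu1]
  refine ⟨fun y hy ↦ ⟨fun q hq ↦ hf.surjective_mfderiv_of_inner_lt_zero hround hu0 hu1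
      (by rw [hq]; exact hy), hf.nonempty_linearEquiv_of_inner_lt_zero hround hu0 hu1 hyl hy el⟩,
    fun y hy ↦ ⟨fun q hq ↦ hf.surjective_mfderiv_of_inner_lt_zero hround hnu0 hnu1
      (by rw [hq]; exact hy), ?_⟩⟩
  obtain ⟨yh, hregh, ⟨eh⟩⟩ := hf.exists_higher
  rcases hf.inner_lt_zero_or_of_regular hround hu0 hu1 hregh with hP | hN
  · -- the genus-`h + 1` fibre cannot lie on the side of the genus-`h` fibre
    exfalso
    obtain ⟨e'⟩ := hf.nonempty_linearEquiv_of_inner_lt_zero hround hu0 hu1 hyl hP el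
    have := (eh.trans e'.symm).finrank_eq
    simp only [Module.finrank_fin_fun] at this
    omega
  · exact hf.nonempty_linearEquiv_of_inner_lt_zero hround hnu0 hnu1 hN hy eh

/-- **The lower and the higher side of a Lefschetz-free SBLF with equatorial round image**
(Baykur–Kamada 2015, §2).  Let `f : X → S²` be a simplified broken Lefschetz fibration on a closed
4-manifold without Lefschetz points (`L = ∅`, lower genus `h`) whose round image is the equator
`{y | y₂ = 0}`.  Then there is a pole `v = ±e₂` (`v₀ = v₁ = 0`) such that every point `y` of the
open hemisphere opposite `v` is a regular value with `H₁(f⁻¹(y); ℤ) ≅ ℤ^{2h}` — **the lower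
side** — and every point `y` of the open hemisphere opposite `-v` is a regular value with
`H₁(f⁻¹(y); ℤ) ≅ ℤ^{2(h+1)}` — **the higher side**.  (With
`exists_isSmoothEmbedding_prod_range_eq_preimage_hemisphere` for `v` and `-v`: the lower side is
`F₋ × ℝ²`, the higher side `F₊ × ℝ²`, `F±` closed connected surfaces of genus `h`, `h + 1`.)
[cite: BaykurKamada2015, §2 (arXiv p. 7)] -/
theorem exists_pole_lower_higher_sides (hf : IsSimplifiedBrokenLefschetzFibration o f ∅ h)
    (hround : f '' ({p : X | ¬ Surjective (mfderiv (𝓡 4) (𝓡 2) f p)} \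
      (↑(∅ : Finset X) : Set X)) = sphereEquator 1) :
    ∃ v : (Metric.sphere (0 : EuclideanSpace ℝ (Fin 3)) 1),
          (v : EuclideanSpace ℝ (Fin 3)) 0 = 0 ∧ (v : EuclideanSpace ℝ (Fin 3)) 1 = 0 ∧
      (∀ y : (Metric.sphere (0 : EuclideanSpace ℝ (Fin 3)) 1), ⟪(y : EuclideanSpace ℝ (Fin 3)),
            (v : EuclideanSpace ℝ (Fin 3))⟫_ℝ < 0 →
        (∀ q, f q = y → Surjective (mfderiv (𝓡 4) (𝓡 2) f q)) ∧
        Nonempty ((Fin (2 * h) → ℤ) ≃ₗ[ℤ] singularHomology ℤ ℤ ↥(f ⁻¹' {y}) 1)) ∧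
      ∀ y : (Metric.sphere (0 : EuclideanSpace ℝ (Fin 3)) 1), ⟪(y : EuclideanSpace ℝ (Fin 3)),
            ((-v : (Metric.sphere (0 : EuclideanSpace ℝ (Fin 3)) 1)) : EuclideanSpace ℝ (Fin 3))⟫_ℝ
            < 0 →
        (∀ q, f q = y → Surjective (mfderiv (𝓡 4) (𝓡 2) f q)) ∧
        Nonempty ((Fin (2 * (h + 1)) → ℤ) ≃ₗ[ℤ] singularHomology ℤ ℤ ↥(f ⁻¹' {y}) 1) := by
  let P : (Metric.sphere (0 : EuclideanSpace ℝ (Fin 3)) 1) := ⟨EuclideanSpace.single 2 1, by simp⟩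
  have hP0 : (P : EuclideanSpace ℝ (Fin 3)) 0 = 0 := by simp [P]
  have hP1 : (P : EuclideanSpace ℝ (Fin 3)) 1 = 0 := by simp [P]
  have hnP0 : ((-P : (Metric.sphere (0 : EuclideanSpace ℝ (Fin 3)) 1)) : EuclideanSpace ℝ (Fin 3))
        0 = 0 := by rw [coe_neg_sphere]; simp [hP0]
  have hnP1 : ((-P : (Metric.sphere (0 : EuclideanSpace ℝ (Fin 3)) 1)) : EuclideanSpace ℝ (Fin 3))
        1 = 0 := by rw [coe_neg_sphere]; simp [hP1]
  obtain ⟨yl, hregl, ⟨el⟩⟩ := hf.exists_lower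
  rcases hf.inner_lt_zero_or_of_regular hround hP0 hP1 hregl with hl | hl
  · exact ⟨P, hP0, hP1, hf.lower_higher_sides_of_pole hround hP0 hP1 hl el⟩
  · refine ⟨-P, hnP0, hnP1, ?_⟩
    have key := hf.lower_higher_sides_of_pole hround hnP0 hnP1 hl el
    rw [neg_neg] at key ⊢
    exact key

omit h in
/-- **Genus one: the sphere side and the torus side** (Baykur–Kamada 2015, §5: *"`X_h ≅ T² × D²`
… `X_l ≅ S² × D²`"*, open form over the open hemispheres).  For a genus-one Lefschetz-free
SBLF (`IsSimplifiedBrokenLefschetzFibration o f ∅ 0`, `X : Type`) with equatorial round image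
there is a pole `v = ±e₂` such that every fibre over the open hemisphere opposite `v` is an
embedded `2`-sphere (`SimplifiedBrokenLefschetzFibreSphere.lean`) and every fibre over the open
hemisphere opposite `-v` is regular with `rank_ℤ H₁ = 2`. [cite: BaykurKamada2015, §5 and Lemma 11] -/
theorem exists_pole_sphere_side {X : Type} [TopologicalSpace X] [T2Space X]
    [SecondCountableTopology X] [CompactSpace X] [ChartedSpace (EuclideanSpace ℝ (Fin 4)) X]
    [IsManifold (𝓡 4) ∞ X] {o : SmoothOrientation (𝓡 4) X} {f : X → (Metric.sphere (0 :
          EuclideanSpace ℝ (Fin 3)) 1)}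
    (hf : IsSimplifiedBrokenLefschetzFibration o f ∅ 0)
    (hround : f '' ({p : X | ¬ Surjective (mfderiv (𝓡 4) (𝓡 2) f p)} \
      (↑(∅ : Finset X) : Set X)) = sphereEquator 1) :
    ∃ v : (Metric.sphere (0 : EuclideanSpace ℝ (Fin 3)) 1),
          (v : EuclideanSpace ℝ (Fin 3)) 0 = 0 ∧ (v : EuclideanSpace ℝ (Fin 3)) 1 = 0 ∧
      (∀ y : (Metric.sphere (0 : EuclideanSpace ℝ (Fin 3)) 1), ⟪(y : EuclideanSpace ℝ (Fin 3)),
            (v : EuclideanSpace ℝ (Fin 3))⟫_ℝ < 0 →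
        (∀ q, f q = y → Surjective (mfderiv (𝓡 4) (𝓡 2) f q)) ∧
        ∃ s : (Metric.sphere (0 : EuclideanSpace ℝ (Fin 3)) 1) → X,
              ContMDiff (𝓡 2) (𝓡 4) ∞ s ∧ Topology.IsEmbedding s ∧
          range s = f ⁻¹' {y}) ∧
      ∀ y : (Metric.sphere (0 : EuclideanSpace ℝ (Fin 3)) 1), ⟪(y : EuclideanSpace ℝ (Fin 3)),
            ((-v : (Metric.sphere (0 : EuclideanSpace ℝ (Fin 3)) 1)) : EuclideanSpace ℝ (Fin 3))⟫_ℝ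
            < 0 →
        (∀ q, f q = y → Surjective (mfderiv (𝓡 4) (𝓡 2) f q)) ∧
        Module.finrank ℤ (singularHomology ℤ ℤ ↥(f ⁻¹' {y}) 1) = 2 := by
  obtain ⟨v, hv0, hv1, hlo, hhi⟩ := hf.exists_pole_lower_higher_sides hround
  refine ⟨v, hv0, hv1, fun y hy ↦ ?_, fun y hy ↦ ?_⟩
  · obtain ⟨hreg, hN⟩ := hlo y hy
    exact ⟨hreg, hf.exists_sphere_two_fibre_of_linearEquiv_fin_zero hreg hN⟩
  · obtain ⟨hreg, ⟨e⟩⟩ := hhi y hy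
    refine ⟨hreg, ?_⟩
    rw [← e.finrank_eq]
    simp

/-- **Genus one: the lower side is `𝕊² × ℝ²`, smoothly and fibrewise** (Baykur–Kamada 2015,
§5: *"`X_l ≅ S² × D²`"*, open form).  For a genus-one Lefschetz-free SBLF
(`IsSimplifiedBrokenLefschetzFibration o f ∅ 0`, `X : Type`) with equatorial round image there
are a pole `v = ±e₂` and a smooth embedding `ι : 𝕊² × ℝ² ↪ X` onto the side
`f⁻¹{y | ⟪y, v⟫ < 0}` with `ι (·, 0)` a smooth embedding onto the central fibre `f⁻¹(-v)` and
`f (ι (θ, w)) = σᵥ⁻¹ (univBall 0 2 w)` (`σᵥ = stereographic' 2 v`); the opposite side is the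
torus side (regular fibres with `rank_ℤ H₁ = 2`).  Assembled from `exists_pole_lower_higher_sides`,
the smoothly embedded sphere fibre `exists_isSmoothEmbedding_sphere_two_fibre_of_linearEquiv_fin_zero`
(`SimplifiedBrokenLefschetzFibreSphere.lean`) and the product structure over a hemisphere of
regular values `exists_isSmoothEmbedding_prod_range_eq_preimage_hemisphere`
(`SimplifiedBrokenLefschetzSides.lean`). [cite: BaykurKamada2015, §5 and Lemma 11]
[cite: BrockerJanichIDT1982, (8.12)] -/
theorem exists_pole_isSmoothEmbedding_sphere_two_prod_side {X : Type} [TopologicalSpace X]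
    [T2Space X] [SecondCountableTopology X] [CompactSpace X]
    [ChartedSpace (EuclideanSpace ℝ (Fin 4)) X] [IsManifold (𝓡 4) ∞ X]
    {o : SmoothOrientation (𝓡 4) X} {f : X → (Metric.sphere (0 : EuclideanSpace ℝ (Fin 3)) 1)}
    (hf : IsSimplifiedBrokenLefschetzFibration o f ∅ 0)
    (hround : f '' ({p : X | ¬ Surjective (mfderiv (𝓡 4) (𝓡 2) f p)} \
      (↑(∅ : Finset X) : Set X)) = sphereEquator 1) :
    ∃ (v : (Metric.sphere (0 : EuclideanSpace ℝ (Fin 3)) 1)) (ι : (Metric.sphere (0 :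
          EuclideanSpace ℝ (Fin 3)) 1) × EuclideanSpace ℝ (Fin 2) → X),
          (v : EuclideanSpace ℝ (Fin 3)) 0 = 0 ∧ (v : EuclideanSpace ℝ (Fin 3)) 1 = 0 ∧
      Manifold.IsSmoothEmbedding ((𝓡 2).prod (𝓡 2)) (𝓡 4) ∞ ι ∧
      range ι = f ⁻¹' {y | ⟪(y : EuclideanSpace ℝ (Fin 3)), (v : EuclideanSpace ℝ (Fin 3))⟫_ℝ < 0} ∧
      Manifold.IsSmoothEmbedding (𝓡 2) (𝓡 4) ∞ (fun θ ↦ ι (θ, 0)) ∧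
      range (fun θ ↦ ι (θ, 0)) = f ⁻¹' {-v} ∧
      (∀ p, f (ι p) = (stereographic' 2 v).symm (univBall (0 : EuclideanSpace ℝ (Fin 2)) 2 p.2)) ∧
      ∀ y : (Metric.sphere (0 : EuclideanSpace ℝ (Fin 3)) 1), ⟪(y : EuclideanSpace ℝ (Fin 3)),
            ((-v : (Metric.sphere (0 : EuclideanSpace ℝ (Fin 3)) 1)) : EuclideanSpace ℝ (Fin 3))⟫_ℝ
            < 0 →
        (∀ q, f q = y → Surjective (mfderiv (𝓡 4) (𝓡 2) f q)) ∧
        Module.finrank ℤ (singularHomology ℤ ℤ ↥(f ⁻¹' {y}) 1) = 2 := by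
  obtain ⟨v, hv0, hv1, hlo, hhi⟩ := hf.exists_pole_lower_higher_sides hround
  obtain ⟨hregv, hNv⟩ := hlo (-v) (inner_neg_self_lt_zero v)
  obtain ⟨s, hs, hsr⟩ := hf.exists_isSmoothEmbedding_sphere_two_fibre_of_linearEquiv_fin_zero hregv
        hNv
  have hreg : ∀ q, ⟪(f q : EuclideanSpace ℝ (Fin 3)),
        (v : EuclideanSpace ℝ (Fin 3))⟫_ℝ < 0 → Surjective (mfderiv (𝓡 4) (𝓡 2) f q) :=
    fun q hq ↦ (hlo (f q) hq).1 q rfl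
  have hdim : Module.finrank ℝ (EuclideanSpace ℝ (Fin 2) × EuclideanSpace ℝ (Fin 2)) =
        Module.finrank ℝ (EuclideanSpace ℝ (Fin 4)) := by
    rw [Module.finrank_prod, finrank_euclideanSpace_fin, finrank_euclideanSpace_fin]
  let L : (EuclideanSpace ℝ (Fin 2) × EuclideanSpace ℝ (Fin 2)) ≃L[ℝ] EuclideanSpace ℝ (Fin 4) :=
        ContinuousLinearEquiv.ofFinrankEq hdim
  obtain ⟨ι, hemb, hrange, hι0, hιf⟩ :=
    Literature.Topology.FourManifolds.exists_isSmoothEmbedding_prod_range_eq_preimage_hemisphere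
      (I := 𝓡 4) (IF := 𝓡 2) hf.contMDiff v hreg hs L hsr
  have hισ : (fun θ ↦ ι (θ, 0)) = s := funext hι0
  refine ⟨v, ι, hv0, hv1, hemb, hrange, ?_, ?_, hιf, fun y hy ↦ ?_⟩
  · rw [hισ]; exact hs
  · rw [hισ]; exact hsr
  · obtain ⟨hregy, ⟨e⟩⟩ := hhi y hy
    refine ⟨hregy, ?_⟩
    rw [← e.finrank_eq]
    simp

end IsSimplifiedBrokenLefschetzFibration

end Literature.Topology.FourManifolds

end
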